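import Literature.MathematicalPhysics.QuantumFieldTheory.Balaban1983to89.Node00.Record5C
import Literature.MathematicalPhysics.QuantumFieldTheory.Balaban1983to89.B14NodeKnitRecord5

/-!
# `Balaban1983to89.B14NodeKnitRecord5C` — YM-DAG node N11 · [Balaban1988Convergent] CMP **119** (1988) 243–285, Theorem 1 p. 262
# (with the Theorem of p. 245 and the ASSUMED operation 𝐑 of p. 244): the N11 knit AT NODE 00's STAGE-5 RECORD PREDICATE OF RECORD
# `Node00.IsRecordOfRecord₅C F N D w` (C-binding, pub-ymgap chair R434 (Q2) = (C)) — and, binding-agnostically, at ANY world carrying the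
# record's construction whose `rOperation` leaf at the run is the bound leaf of the record's 𝐑-carrier

statement-level bookkeeping over published theorems with citation tags; kernel-checked compositions of tree theorems;
nothing here is a claim about the Yang–Mills mass gap.

CITATION HEADER (lean-in-tree rule).  Source: T. Bałaban, *Convergent renormalization expansions for lattice gauge theories*,
Commun. Math. Phys. **119**, 243–285 (1988), doi:10.1007/bf01217741 [Balaban1988Convergent] (cell paper B14 = «[III]»).  Seat
`pub-ymgap-dag-n11-a` (YM-PLAN Track A, HUMAN RULING D-0062: the KNIT-BY-NAME seat of node N11; R420 ∕ R422 ∕ R424 ∕ R434).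
BY NAME and UNCHANGED: `…B14NodeKnitRecord5` (`b14_main_at_stage5Params`, `densitiesDescribed_iff_S218`), `…B14NodeKnitMachine`
(`b14_main_of_machine_record`), `…Node00.Record5C` (seat pub-ymgap-node00-def: `IsRecordOfRecord₅C`, `upOfRecord₅C`, `upOfRecord₅C_b10_iff`,
`rebind_of_isRecordOfRecord₅C`), `…Node00.Record5` (`Stage5Params`, `Residual₅`, `machineOfRecord₅`, `densOfRecord₅`, `datumOfRecord₅`,
`upOfRecord₅`, `dens_machineOfRecord₅`), `…Node00.DatumAvLayer` (`TrhoOfRecord`, `rhoZeroOfRecord`), `…Dag` (`B14_main` :224), `…DagBinding`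
(`leavesP`, `ROpLeaf`), `…B14` (`RAssumedP244`), `…B10CompactBinding` (`withB10`), `…DagDischarged` (`b10Compact`).

WHY A SECOND RECORD-LEVEL FILE.  `B14NodeKnitRecord5` knits N11 at `Node00.IsRecordOfRecord₅`, whose upstream block is the N-binding
`upOfRecord₅ θ P` with the LITERAL [Balaban1985UV3] leaf `b10`.  The predicate OF RECORD for the route «BalabanUVNodes» and for the refinements
`₆ ₇ ₈ → ₅C` is `Node00.IsRecordOfRecord₅C` (module `Record5C`): the same Stage-5 objects, the upstream block re-bound in the ONE slot `b10 :=
DagDischarged.b10Compact …` ([Balaban1985UV3] Thm 1 in the compact reading ∧ Thm 2).  For N11 the re-binding is immaterial to the KNIT — the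
node reads `b10` only as an antecedent handed to the T-step slot, and its own two ends (`rOperation`, `densitiesDescribed`) are the N-binding's
(`Record5C.upOfRecord₅C_leaves`, `rfl`) — but it matters to the CONTENT: at the N-binding the antecedent `b10` is the literal reading, refuted on
fine-lattice run families (`BalabanUVNodesN08Concrete`), so N11-at-₅ can hold vacuously there; at ₅C the antecedent is the compact reading and
the slot (S1) receives [Balaban1985UV3] in the form the series uses it.  This file therefore (§0) states the knit ONCE binding-agnostically —
at any world with `w.C = (datumOfRecord₅ θ).C` whose `rOperation` leaf at `P` IS `ROpLeaf (θ.res.V P)` — and instantiates it (§1) at the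
C-binding of record and (§2) at the predicate `IsRecordOfRecord₅C`, giving the `S_N11 Rec₅C` shape a `stub_N11` over the predicate of record takes.

WHAT THIS FILE PROVES (0 `sorry`, 0 `def`, standard axioms).
§0 `b14_main_at_stage5Params_of_rOperation_iff` — N11 at `(w, P)` for ANY world bound to the datum of record at `θ` whose `rOperation` leaf at
   `P` is (equivalent to) the bound leaf of the residual 𝐑-carrier, from (P1₅), (P3₅), (S0), (S1) exactly as in `B14NodeKnitRecord5` (whose
   `b14_main_at_stage5Params` is the instance `hup ▸ Iff.rfl`); `…_S218` with `S := θ.res.S218 P`.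
§1 At the C-binding of record `w.up P = upOfRecord₅C θ P`: `rOperation_iff_rOpLeaf_res_C` (the node's 𝐑-hypothesis IS `ROpLeaf (θ.res.V P)`,
   `Iff.rfl` after rewriting), `b10_iff_compact_C` (the node's `b10` antecedent IS [Balaban1985UV3] Thm 1 compact ∧ Thm 2 over the record's run
   family — located, for the slot's consumer), `b14_main_at_stage5Params_C`, `b14_main_at_stage5Params_C_S218`.
§2 **`b14_main_of_isRecordOfRecord₅C`** — THE KNIT AT THE PREDICATE OF RECORD; `b14_main_forall_isRecordOfRecord₅C` — the `S_N11 Rec₅C` shape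
   `∀ D w, IsRecordOfRecord₅C F N D w → ∀ P, Dag.B14_main (leavesP w P)` from the slots stated once over all admissible `θ`; `…_iff_rebind` — N11's
   two ENDS at a ₅C record agree with those at its literal re-binding `{w with up := upOfRecord₅ θ}` (a `Record5` record, `rebind_of_isRecordOfRecord₅C`).

HONEST FRAMING.  A count-neutral SLOT landing (R429 (4)(i)): N11 is NOT discharged; (S1) = Sects. 1–3 of [Balaban1988Convergent] at the objects
of record is a displayed hypothesis (closed form waits on NODE 00 Stage 6's format predicates replacing `Residual₅.S218`); (P1₅) waits on the
Stage-7∕7b 𝐑-carrier of record.  The 𝐑 operation is the printed ASSUMPTION of p. 244.  One finite four-torus programme at fixed `ε`, Bałaban AS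
PRINTED with locators; nothing continuum ∕ ℝ⁴ ∕ OS ∕ mass gap ∕ Clay.
-/

noncomputable section

namespace Literature.MathematicalPhysics.QuantumFieldTheory.Balaban1983to89.B14NodeKnitRecord5C

open DagBinding T4DatumAssembly T4Continuum Node00
open B14NodeKnitRecord5 (densitiesDescribed_iff_S218)

variable (F : T4Family) (N : ℕ) [NeZero N]

/-! ## §0. Binding-agnostic: any world carrying the record's construction whose `rOperation` leaf at `P` is the record's bound 𝐑-leaf -/

section AnyBinding

variable (θ : Stage5Params F N) (w : WorldP) (P : B12.RunParams)

/-- **N11 AT THE STAGE-5 PARAMETERS `θ`, BINDING-AGNOSTIC** ([Balaban1988Convergent] Thm 1 p. 262 with the Theorem of p. 245 and the assumed 𝐑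
of p. 244): for a world bound to the datum of record at `θ` (`hC`) whose `rOperation` leaf at the run `P` is (equivalent to) the bound leaf of
the residual 𝐑-carrier `ROpLeaf (θ.res.V P)` (`hrop` — the N-binding `upOfRecord₅`, the C-binding of record `upOfRecord₅C`, or any re-binding
that leaves the [III] slot alone), `Dag.B14_main (leavesP w P)` follows from the two located pins on the residual fields — (P1₅) `hV`, (P3₅)
`hS` — and EXACTLY TWO DISPLAYED PRINTED SLOTS: (S0) `h0` the Wilson start of record lies in the index-0 space, under the interval hypothesis;
(S1) `hT` THE THEOREM OF p. 245 along the record's tower `densOfRecord₅ θ P` through `TrhoOfRecord F N P.K k`, GIVEN the in-edges `b7 … b11` (at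
THIS world's binding), the interval hypothesis, the small-field inductive assumptions and the flow control (2.6).  Proof =
`B14NodeKnitMachine.b14_main_of_machine_record` at `machineOfRecord₅ θ` + `dens_machineOfRecord₅`.  Count-neutral; nothing of Sects. 1–3
asserted. [cite: Balaban1988Convergent, Thm 1 p.262; Theorem p.245; p.244] -/
theorem b14_main_at_stage5Params_of_rOperation_iff (hC : w.C = (datumOfRecord₅ F N θ).C)
    (hrop : (w.up P).rOperation ↔ ROpLeaf (θ.res.V P))
    (S Scorr : (k : ℕ) → Density (F.P P.K) k (SU N) → Prop)
    (hV : ROpLeaf (θ.res.V P) → B14.RAssumedP244 (θ.res.R P) Scorr S P.K)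
    (hS : ∀ k, k ≤ P.K → S k (densOfRecord₅ F N θ P k) → θ.res.S218 P k (densOfRecord₅ F N θ P k))
    (h0 : (leavesP w P).smallCouplings → S 0 (rhoZeroOfRecord F N P.K P.g0 (θ.res.E P)))
    (hT : (leavesP w P).b7 → (leavesP w P).b8 → (leavesP w P).b9 → (leavesP w P).b10 → (leavesP w P).b11 →
      (leavesP w P).smallCouplings → (leavesP w P).smallFieldInductive → (leavesP w P).flowControl →
        ∀ k, k < P.K → S k (densOfRecord₅ F N θ P k) →
          Scorr (k + 1) (TrhoOfRecord F N P.K k (densOfRecord₅ F N θ P k))) :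
    Dag.B14_main (leavesP w P) := by
  refine B14NodeKnitMachine.b14_main_of_machine_record F N (machineOfRecord₅ F N θ) w P hC S Scorr ?_ ?_ h0 ?_
  · intro hr
    exact hV (hrop.1 hr)
  · intro k hk h
    rw [dens_machineOfRecord₅] at h
    exact hS k hk h
  · intro h7 h8 h9 h10 h11 hsc hsf hfc k hk h
    rw [dens_machineOfRecord₅] at h ⊢
    exact hT h7 h8 h9 h10 h11 hsc hsf hfc k hk h

/-- The same with the index-`k` space THE (2.18) FORMAT ITSELF, `S := θ.res.S218 P` (no pin (P3₅)). [cite: Balaban1988Convergent, Thm 1 p.262; Theorem p.245; p.244] -/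
theorem b14_main_at_stage5Params_of_rOperation_iff_S218 (hC : w.C = (datumOfRecord₅ F N θ).C)
    (hrop : (w.up P).rOperation ↔ ROpLeaf (θ.res.V P))
    (Scorr : (k : ℕ) → Density (F.P P.K) k (SU N) → Prop)
    (hV : ROpLeaf (θ.res.V P) → B14.RAssumedP244 (θ.res.R P) Scorr (θ.res.S218 P) P.K)
    (h0 : (leavesP w P).smallCouplings → θ.res.S218 P 0 (rhoZeroOfRecord F N P.K P.g0 (θ.res.E P)))
    (hT : (leavesP w P).b7 → (leavesP w P).b8 → (leavesP w P).b9 → (leavesP w P).b10 → (leavesP w P).b11 →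
      (leavesP w P).smallCouplings → (leavesP w P).smallFieldInductive → (leavesP w P).flowControl →
        ∀ k, k < P.K → θ.res.S218 P k (densOfRecord₅ F N θ P k) →
          Scorr (k + 1) (TrhoOfRecord F N P.K k (densOfRecord₅ F N θ P k))) :
    Dag.B14_main (leavesP w P) :=
  b14_main_at_stage5Params_of_rOperation_iff F N θ w P hC hrop (θ.res.S218 P) Scorr hV (fun _ _ h => h) h0 hT

/-- **The two ENDS of N11 depend on the world only through `w.C P` and the `rOperation` leaf of `w.up P`**: at a world bound to the datum of
record at `θ` whose 𝐑-leaf at `P` is the record's, «𝐑-hypothesis ⇒ (interval ⇒ densities described)» IS «`ROpLeaf (θ.res.V P)` ⇒ (interval ⇒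
`∀ k ≤ K, θ.res.S218 P k ρ_k`)» at the determined densities of record.  Located bookkeeping for the planner's `stub_N11` text (R422).
[cite: Balaban1988Convergent, Thm 1 p.262; p.244] -/
theorem ends_iff_of_rOperation_iff (hC : w.C = (datumOfRecord₅ F N θ).C) (hrop : (w.up P).rOperation ↔ ROpLeaf (θ.res.V P)) :
    ((leavesP w P).rOperation → (leavesP w P).smallCouplings → (leavesP w P).densitiesDescribed) ↔
      (ROpLeaf (θ.res.V P) → (leavesP w P).smallCouplings →
        ∀ k, k ≤ P.K → θ.res.S218 P k (densOfRecord₅ F N θ P k)) := by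
  have hr : (leavesP w P).rOperation ↔ ROpLeaf (θ.res.V P) := hrop
  rw [hr, densitiesDescribed_iff_S218 F N θ w P hC]

end AnyBinding

/-! ## §1. At the C-binding of record `w.up P = upOfRecord₅C θ P` -/

section AtParamsC

variable (θ : Stage5Params F N) (w : WorldP) (P : B12.RunParams)

/-- At a world whose upstream block at `P` is the C-binding of record, the node's 𝐑-hypothesis IS the bound leaf of the RESIDUAL 𝐑-carrier
`ROpLeaf (θ.res.V P)` — the re-binding touches `b10` only (`Record5C.upOfRecord₅C_leaves`). [cite: Balaban1988Convergent, p.244] -/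
theorem rOperation_iff_rOpLeaf_res_C (hup : w.up P = upOfRecord₅C F N θ P) :
    (leavesP w P).rOperation ↔ ROpLeaf (θ.res.V P) := by
  show (w.up P).rOperation ↔ _
  rw [hup]
  exact Iff.rfl

/-- At a world whose upstream block at `P` is the C-binding of record, the node's `b10` ANTECEDENT IS [Balaban1985UV3] Thm 1 in the COMPACT
reading ∧ Thm 2 over the record's run family `(carriers₃ θ (X P)).runs10` (`Record5C.upOfRecord₅C_b10_iff`) — what the slot (S1) receives as
`(leavesP w P).b10` at the predicate of record. [cite: Balaban1985UV3, Thm 1 p.257 (compact reading) + Thm 2 p.272] -/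
theorem b10_iff_compact_C (hup : w.up P = upOfRecord₅C F N θ P) :
    (leavesP w P).b10 ↔
      B10.Thm1PrintedCompact (carriers₃ θ.toStage3Params (θ.res.X P)).runs10 ∧
        B10.Thm2Printed (carriers₃ θ.toStage3Params (θ.res.X P)).runs10 := by
  show (w.up P).b10 ↔ _
  rw [hup]
  exact upOfRecord₅C_b10_iff F N θ P

/-- **N11 AT THE STAGE-5 PARAMETERS `θ`, C-BINDING OF RECORD** ([Balaban1988Convergent] Thm 1 p. 262 with the Theorem of p. 245 and the assumed
𝐑 of p. 244): `b14_main_at_stage5Params_of_rOperation_iff` at `w.up P = upOfRecord₅C θ P`.  Pins (P1₅) `hV`, (P3₅) `hS`; slots (S0) `h0`, (S1)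
`hT` — the latter's `b10` antecedent now the compact reading (`b10_iff_compact_C`). [cite: Balaban1988Convergent, Thm 1 p.262; Theorem p.245; p.244] -/
theorem b14_main_at_stage5Params_C (hC : w.C = (datumOfRecord₅ F N θ).C) (hup : w.up P = upOfRecord₅C F N θ P)
    (S Scorr : (k : ℕ) → Density (F.P P.K) k (SU N) → Prop)
    (hV : ROpLeaf (θ.res.V P) → B14.RAssumedP244 (θ.res.R P) Scorr S P.K)
    (hS : ∀ k, k ≤ P.K → S k (densOfRecord₅ F N θ P k) → θ.res.S218 P k (densOfRecord₅ F N θ P k))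
    (h0 : (leavesP w P).smallCouplings → S 0 (rhoZeroOfRecord F N P.K P.g0 (θ.res.E P)))
    (hT : (leavesP w P).b7 → (leavesP w P).b8 → (leavesP w P).b9 → (leavesP w P).b10 → (leavesP w P).b11 →
      (leavesP w P).smallCouplings → (leavesP w P).smallFieldInductive → (leavesP w P).flowControl →
        ∀ k, k < P.K → S k (densOfRecord₅ F N θ P k) →
          Scorr (k + 1) (TrhoOfRecord F N P.K k (densOfRecord₅ F N θ P k))) :
    Dag.B14_main (leavesP w P) :=
  b14_main_at_stage5Params_of_rOperation_iff F N θ w P hC (rOperation_iff_rOpLeaf_res_C F N θ w P hup) S Scorr hV hS h0 hT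

/-- The same with `S := θ.res.S218 P` (no pin (P3₅)). [cite: Balaban1988Convergent, Thm 1 p.262; Theorem p.245; p.244] -/
theorem b14_main_at_stage5Params_C_S218 (hC : w.C = (datumOfRecord₅ F N θ).C) (hup : w.up P = upOfRecord₅C F N θ P)
    (Scorr : (k : ℕ) → Density (F.P P.K) k (SU N) → Prop)
    (hV : ROpLeaf (θ.res.V P) → B14.RAssumedP244 (θ.res.R P) Scorr (θ.res.S218 P) P.K)
    (h0 : (leavesP w P).smallCouplings → θ.res.S218 P 0 (rhoZeroOfRecord F N P.K P.g0 (θ.res.E P)))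
    (hT : (leavesP w P).b7 → (leavesP w P).b8 → (leavesP w P).b9 → (leavesP w P).b10 → (leavesP w P).b11 →
      (leavesP w P).smallCouplings → (leavesP w P).smallFieldInductive → (leavesP w P).flowControl →
        ∀ k, k < P.K → θ.res.S218 P k (densOfRecord₅ F N θ P k) →
          Scorr (k + 1) (TrhoOfRecord F N P.K k (densOfRecord₅ F N θ P k))) :
    Dag.B14_main (leavesP w P) :=
  b14_main_at_stage5Params_C F N θ w P hC hup (θ.res.S218 P) Scorr hV (fun _ _ h => h) h0 hT

/-- At the C-binding of record the two ENDS of N11 read exactly as at the N-binding (`ends_iff_of_rOperation_iff`): the re-binding does not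
touch what N11 asserts, only what its `b10` antecedent supplies. [cite: Balaban1988Convergent, Thm 1 p.262; p.244] -/
theorem ends_iff_C (hC : w.C = (datumOfRecord₅ F N θ).C) (hup : w.up P = upOfRecord₅C F N θ P) :
    ((leavesP w P).rOperation → (leavesP w P).smallCouplings → (leavesP w P).densitiesDescribed) ↔
      (ROpLeaf (θ.res.V P) → (leavesP w P).smallCouplings →
        ∀ k, k ≤ P.K → θ.res.S218 P k (densOfRecord₅ F N θ P k)) :=
  ends_iff_of_rOperation_iff F N θ w P hC (rOperation_iff_rOpLeaf_res_C F N θ w P hup)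

end AtParamsC

/-! ## §2. At the record predicate of record `IsRecordOfRecord₅C F N D w` -/

section AtRecordC

variable {F N}
variable {D : FiniteEpsData F (SU N)} {w : WorldP}

/-- **N11 AT NODE 00's STAGE-5 RECORD OF RECORD (C-binding), KNIT BY NAME** ([Balaban1988Convergent] Thm 1 p. 262 with the Theorem of p. 245
and the assumed 𝐑 of p. 244): if `(D, w)` is a Stage-5 record of record (`IsRecordOfRecord₅C F N D w`) and, for the parameters of the record —
every admissible `θ` with `D = datumOfRecord₅ θ` and `w.up = upOfRecord₅C θ` — every run carries space families `S`, `Scorr` with the located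
pins (P1₅), (P3₅) and the displayed printed slots (S0), (S1) of `b14_main_at_stage5Params_C`, then N11 holds at every run.  Count-neutral
slot landing. [cite: Balaban1988Convergent, Thm 1 p.262; Theorem p.245; p.244] -/
theorem b14_main_of_isRecordOfRecord₅C (h : IsRecordOfRecord₅C F N D w)
    (slots : ∀ θ : Stage5Params F N, θ.Admissible → D = datumOfRecord₅ F N θ →
      (∀ P, w.up P = upOfRecord₅C F N θ P) → ∀ P : B12.RunParams,
        ∃ S Scorr : (k : ℕ) → Density (F.P P.K) k (SU N) → Prop,
          (ROpLeaf (θ.res.V P) → B14.RAssumedP244 (θ.res.R P) Scorr S P.K) ∧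
          (∀ k, k ≤ P.K → S k (densOfRecord₅ F N θ P k) → θ.res.S218 P k (densOfRecord₅ F N θ P k)) ∧
          ((leavesP w P).smallCouplings → S 0 (rhoZeroOfRecord F N P.K P.g0 (θ.res.E P))) ∧
          ((leavesP w P).b7 → (leavesP w P).b8 → (leavesP w P).b9 → (leavesP w P).b10 → (leavesP w P).b11 →
            (leavesP w P).smallCouplings → (leavesP w P).smallFieldInductive → (leavesP w P).flowControl →
              ∀ k, k < P.K → S k (densOfRecord₅ F N θ P k) →
                Scorr (k + 1) (TrhoOfRecord F N P.K k (densOfRecord₅ F N θ P k)))) :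
    ∀ P : B12.RunParams, Dag.B14_main (leavesP w P) := by
  intro P
  obtain ⟨θ, hθ, hD, hC, -, -, hup⟩ := h
  obtain ⟨S, Scorr, hV, hS, h0, hT⟩ := slots θ hθ hD hup P
  exact b14_main_at_stage5Params_C F N θ w P (by rw [hC, hD]) (hup P) S Scorr hV hS h0 hT

/-- **The `S_N11 Rec₅C` shape**: `∀ D w, IsRecordOfRecord₅C F N D w → ∀ P, Dag.B14_main (leavesP w P)` from the slots stated ONCE over all
admissible parameters `θ` at the worlds carrying the record's construction and the C-binding of record — the form a `stub_N11` typed over THE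
predicate of record takes (R422), and through `Node00.isRecordOfRecord₅C_of_isRecordOfRecord₇C`-type refinements the form every later stage
inherits.  The slot's antecedents are the node's own at such a world (its `b10` the compact reading, `b10_iff_compact_C`).
[cite: Balaban1988Convergent, Thm 1 p.262; Theorem p.245; p.244] -/
theorem b14_main_forall_isRecordOfRecord₅C
    (slots : ∀ θ : Stage5Params F N, θ.Admissible → ∀ w : WorldP, w.C = (datumOfRecord₅ F N θ).C →
      (∀ P, w.up P = upOfRecord₅C F N θ P) → ∀ P : B12.RunParams,
        ∃ S Scorr : (k : ℕ) → Density (F.P P.K) k (SU N) → Prop,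
          (ROpLeaf (θ.res.V P) → B14.RAssumedP244 (θ.res.R P) Scorr S P.K) ∧
          (∀ k, k ≤ P.K → S k (densOfRecord₅ F N θ P k) → θ.res.S218 P k (densOfRecord₅ F N θ P k)) ∧
          ((leavesP w P).smallCouplings → S 0 (rhoZeroOfRecord F N P.K P.g0 (θ.res.E P))) ∧
          ((leavesP w P).b7 → (leavesP w P).b8 → (leavesP w P).b9 → (leavesP w P).b10 → (leavesP w P).b11 →
            (leavesP w P).smallCouplings → (leavesP w P).smallFieldInductive → (leavesP w P).flowControl →
              ∀ k, k < P.K → S k (densOfRecord₅ F N θ P k) →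
                Scorr (k + 1) (TrhoOfRecord F N P.K k (densOfRecord₅ F N θ P k)))) :
    ∀ (D : FiniteEpsData F (SU N)) (w : WorldP), IsRecordOfRecord₅C F N D w →
      ∀ P : B12.RunParams, Dag.B14_main (leavesP w P) := by
  intro D w h P
  obtain ⟨θ, hθ, hD, hC, -, -, hup⟩ := h
  obtain ⟨S, Scorr, hV, hS, h0, hT⟩ := slots θ hθ w (by rw [hC, hD]) hup P
  exact b14_main_at_stage5Params_C F N θ w P (by rw [hC, hD]) (hup P) S Scorr hV hS h0 hT

/-- With `S := θ.res.S218 P` (no pin (P3₅)): the `S_N11 Rec₅C` shape from (P1₅), (S0), (S1) alone — the form the honest `stub_N11` takes once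
NODE 00 Stage 6 replaces `Residual₅.S218` by the typed (2.18) format (then `S` IS that format and `Scorr` its T-image companion).
[cite: Balaban1988Convergent, Thm 1 p.262; Theorem p.245; p.244] -/
theorem b14_main_forall_isRecordOfRecord₅C_S218
    (slots : ∀ θ : Stage5Params F N, θ.Admissible → ∀ w : WorldP, w.C = (datumOfRecord₅ F N θ).C →
      (∀ P, w.up P = upOfRecord₅C F N θ P) → ∀ P : B12.RunParams,
        ∃ Scorr : (k : ℕ) → Density (F.P P.K) k (SU N) → Prop,
          (ROpLeaf (θ.res.V P) → B14.RAssumedP244 (θ.res.R P) Scorr (θ.res.S218 P) P.K) ∧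
          ((leavesP w P).smallCouplings → θ.res.S218 P 0 (rhoZeroOfRecord F N P.K P.g0 (θ.res.E P))) ∧
          ((leavesP w P).b7 → (leavesP w P).b8 → (leavesP w P).b9 → (leavesP w P).b10 → (leavesP w P).b11 →
            (leavesP w P).smallCouplings → (leavesP w P).smallFieldInductive → (leavesP w P).flowControl →
              ∀ k, k < P.K → θ.res.S218 P k (densOfRecord₅ F N θ P k) →
                Scorr (k + 1) (TrhoOfRecord F N P.K k (densOfRecord₅ F N θ P k)))) :
    ∀ (D : FiniteEpsData F (SU N)) (w : WorldP), IsRecordOfRecord₅C F N D w →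
      ∀ P : B12.RunParams, Dag.B14_main (leavesP w P) := by
  intro D w h P
  obtain ⟨θ, hθ, hD, hC, -, -, hup⟩ := h
  obtain ⟨Scorr, hV, h0, hT⟩ := slots θ hθ w (by rw [hC, hD]) hup P
  exact b14_main_at_stage5Params_C_S218 F N θ w P (by rw [hC, hD]) (hup P) Scorr hV h0 hT

/-- **The two ends of N11 at a ₅C record agree with those at its literal re-binding** `{w with up := upOfRecord₅ F N θ}` (a `Record5` record,
`Record5C.rebind_of_isRecordOfRecord₅C`): same construction, same 𝐑-leaf — so every END-level statement about N11 proved over `IsRecordOfRecord₅`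
transports verbatim; only the `b10` antecedent of the slot differs. [cite: Balaban1988Convergent, Thm 1 p.262; p.244 (bookkeeping)] -/
theorem ends_iff_rebind (θ : Stage5Params F N) (hup : ∀ P, w.up P = upOfRecord₅C F N θ P) (P : B12.RunParams) :
    ((leavesP w P).rOperation → (leavesP w P).smallCouplings → (leavesP w P).densitiesDescribed) ↔
      ((leavesP { w with up := upOfRecord₅ F N θ } P).rOperation →
        (leavesP { w with up := upOfRecord₅ F N θ } P).smallCouplings →
          (leavesP { w with up := upOfRecord₅ F N θ } P).densitiesDescribed) := by
  have h1 : (leavesP w P).rOperation ↔ ROpLeaf (θ.res.V P) := rOperation_iff_rOpLeaf_res_C F N θ w P (hup P)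
  have h2 : (leavesP { w with up := upOfRecord₅ F N θ } P).rOperation ↔ ROpLeaf (θ.res.V P) :=
    B14NodeKnitRecord5.rOperation_iff_rOpLeaf_res F N θ _ P rfl
  rw [h1, h2]
  exact Iff.rfl

end AtRecordC

end Literature.MathematicalPhysics.QuantumFieldTheory.Balaban1983to89.B14NodeKnitRecord5C

end
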